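import Summits.QuantumFields.BalabanUV.T4Continuum.Spine.NE1p.DressedSourceAnalyticOnCores

/-!
# T⁴ programme, spine estimate NE1′ (node O3b/H2) — THE RE-BORN μ-PART IS BILINEAR IN (SOURCE, CONTENT): the DRESSED regeneration
# constant `4M∕(μ₁ε)` by the Schwarz lemma ITERATED on the (source, strength) BIDISC, fed — with (B1a) discharged — by S33 §2's
# parametric END at `P := ℂ × ℂ`, for exp-linear families and for (2.14)-cores with term-dependent polymer families

Cell `pub-balaban`, sub-cell `t4`, BINDER-OWNERS row NE1′; NE1′ formalisation crew, unit `b2b-balaban-t4-ne1p-formalise-leaf-03`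
(LEAF PROVER 03, generation 14); crew row S⟨next⟩ of `t4/formal/NE1p/LEAVES.md` (own-lineage follower of S33 `DressedSourceAnalyticOnCores`
(p230131), S52 `DressedRegenerationOnCores` (p238661) and the «linear in the content» row `DressedRegenerationLinear`, in the owner's
`DressedSmallFieldAllowance` (p218876) §1∕§3 currency).  ADDITIVE — imports S33 `Spine/NE1p/DressedSourceAnalyticOnCores` ONLY (→ N0r ∕ N0q ∕
N0p ∕ N0n ∕ N0j → `DressedSmallFieldSeries` → `DressedSmallFieldAllowance`, row NE5's `B13Term*`); THEOREMS ONLY (0 def, 0 `def … : Prop`,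
0 cite); nothing restated.

WHY THIS FILE.  What the DRESSED budget of a trajectory books for a family re-born at a small-field step is the OBSERVABLE-ATTACHED part
of what the family's content regenerates — `DressedSmallFieldAllowance`'s title «the regeneration constant of the RE-BORN μ-PARTS by the
Schwarz lemma».  In the tree the two Schwarz faces exist SEPARATELY: §2 `muPart_norm_le` ∕ `_of_window` (the μ-part `E(μ) − E(0)` of an
output holomorphic in the source, `≤ (2M∕μ₁)·|μ|`) and §3 `regen_le_of_slack` (the content-sourced part `E(1) − E(0)` of an output
holomorphic in the strength, `≤ (2M∕ε)·σ`); N0j ∕ S33 ∕ S52 ∕ `DressedRegenerationLinear` carry each to the cores with (B1a) discharged.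
The μ-part OF the content-sourced part — the MIXED difference `E(μ,1) − E(0,1) − E(μ,0) + E(0,0)` of the output as a function of BOTH the
source `μ` and the strength `s` — has no face in `Spine/NE1p` ∕ `Support` (grep «mixed difference ∕ bidisc ∕ re-born», 2026-08-20: the
Allowance header's words only).  This file types it:
* §1 [folklore — Schwarz ITERATED on the bidisc] `rebornMuPart_le_of_bidisc`: for `E : ℂ × ℂ → F` complex differentiable on
  `ball 0 μ₁ ×ˢ ball 0 (ε∕σ)` and bounded by `M` there, `0 < σ < ε`, `|μ| < μ₁`:
  `‖E(μ,1) − E(0,1) − (E(μ,0) − E(0,0))‖ ≤ 2·(2M∕μ₁·|μ|)∕ε·σ` (Allowance §1 `norm_sub_le_of_ball` in the source at EVERY strength gives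
  the s-holomorphic function `G(s) = E(μ,s) − E(0,s)` the bound `2M|μ|∕μ₁` on the strength disc; Allowance §3 `regen_le_of_slack` on `G`);
  `rebornMuPart_le_of_window`: on `|μ| ≤ μ₀ < μ₁`, `≤ (4·M·μ₀∕(μ₁·ε))·σ` — BILINEAR in (source window, content size) with the DRESSED
  regeneration constant `c̄_μ = 4Mμ₀∕(μ₁ε)`, free of `μ` and of the content.
* §2 `rebornMuPart_locE_le_of_expLinear` (kernel; S33 §2 `analytic_and_bounded_locE_param_of_expLinear` EXACTLY ONCE at
  `P := ℂ × ℂ`, `S := ball 0 μ₁ ×ˢ ball 0 (ε∕σ)` — JOINT holomorphy of the dressed output in (source, strength) along an abstract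
  table map `hc : ℂ × ℂ → Hist`, (B1a) discharged through row NE5's `TermHistExpLinear` — then §1 ONCE): the mixed difference of
  `E[act (μ,s)](X₀)` is `≤ 2·(2M∕μ₁·|μ|)∕ε·σ` with the print-shaped `M = e·ν·c₁·K₀²·A·e^{−r₁ d(X₀)}`.
* §3 `rebornMuPart_locE_le_of_coresAt_bipencil_mass` (kernel; S33 §2's param END ONCE via `termHistExpLinear_termAt` (N0r §1) on the
  BI-PENCIL `h₀ + μ • u + s • v` — source direction `u`, content `v` —, class membership and read-out growth by N0p's `pencil_mem_ballClass` ∕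
  `norm_pencil_le` applied TWICE (base `h₀ + μ • u`), (B3) as N0q's letter budget via `norm_integral_coreDensity_le` termwise — S33 §3's
  proof pattern; then §1): binders = S33 §3's with the pencil doubled: `0 < ‖v‖ < ε`, `hH : ‖h₀ − ctr.2‖ + μ₁‖u‖ + ε ≤ RHist k`, `hact` on
  `ball 0 μ₁ ×ˢ ball 0 (ε∕‖v‖)`, `hM3` at the table radius `‖h₀‖ + μ₁‖u‖ + ε`; conclusion for `|μ| < μ₁`:
  `‖E[act(μ,1)](X₀) − E[act(0,1)](X₀) − (E[act(μ,0)](X₀) − E[act(0,0)](X₀))‖ ≤ 2·(2M∕μ₁·|μ|)∕ε·‖v‖`; `…_of_window`: `≤ (4Mμ₀∕(μ₁ε))·‖v‖`.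

WHAT STAYS DISPLAYED (binders, by name; NOTHING instantiated on Bałaban's densities): `hroom`; the Gaussian letter blocks `hm`∕`hN`∕`hq`;
`hO`∕`hH` (room for BOTH directions); (B1b)'s residue `terms`∕`emb`∕`hscale`; the clause SHAPES; (B3) = `hM3` (G-ne9p2-5, UNPRINTED, shared
with NE9, a BINDER); the source radius `μ₁` ∕ window `μ₀` and the content's room `ε` with `‖v‖ < ε`.  WHICH table is the observable's
source direction `u` (print's `μ·(obs)` entry of the potential table), which is a booked family's content 𝐖, and which room print's clauses
leave are the owner's READINGS (skeleton leaves L-R ∕ L-P; `DressedSmallFieldAllowance` §2–§4), not asserted here; `4M∕(μ₁ε)` is a READING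
of the dressed (w5) constant along the bi-pencil — (B1a) discharged at the cores, (w5) NOT discharged on Bałaban's densities.

HONEST FRAMING.  §1 is textbook complex analysis (kernel, Mathlib's Schwarz lemma through the owner's Allowance §1∕§3 BY NAME); §2∕§3 are
by-name compositions over SHAPES (S33's parametric END is this unit's; its (B1a) discharge is a relocation onto row NE5's exp-linear FORMAT
hypothesis whose identification with Bałaban's (2.14) is the substrate's DISPLAYED reading, NOT claimed); (B1b) ∕ (B3) ∕ (B5) NOT
discharged; 0 binders instantiated on Bałaban's densities; no new inequality beyond [folklore] Schwarz; no wall item of NE1′ or NE5 moves;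
the NE1′ wall wording of record v1.8 (T4-DAG v48) — words, not kind — does NOT move; R-t4r2-Q2 NOT met; ABSOLUTE RULE honoured ([folklore]
kernel lemmas only; (2.14) p. 15, (2.38) p. 20, (2.41) p. 21 of [Balaban1988RGII] are LOCI quoted in the imported modules with their tags;
no numeral of print; no disputed step of the audited manuscripts enters as a fact).  NE1′ ⇐ the named binders — NOT proved, NOT printed;
spine PROVED 0∕9; count 9 unchanged.  Rung (B)+1 on ONE finite four-torus — NOT infinite volume, NOT a mass gap, NOT OS on ℝ⁴, NOT
Clay.  HONEST DEPENDENCY: continuum YM on T⁴ ⇐ BetaPertH ∧ nine spine estimates (0/9 proved); BetaPertH ⇐ (D1) ∧ (D4) ∧ CAP+tail;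
G-an2-4 gates asym, D1 and NE2/3/4.
-/

noncomputable section

namespace Summit.QuantumFields.BalabanUV.T4Continuum.NE1p.DressedRebornMuPart

open scoped BigOperators
open Metric Set MeasureTheory
open Literature.MathematicalPhysics.QuantumFieldTheory.Balaban1983to89
open Literature.MathematicalPhysics.QuantumFieldTheory.Balaban1983to89.T4OutputRate (Carriers)
open Literature.MathematicalPhysics.QuantumFieldTheory.Balaban1983to89.B13Resummation (locE Geometry)
open Literature.MathematicalPhysics.QuantumFieldTheory.Balaban1983to89.T4InputCauchyRateSpecies (ballClass)
open Literature.MathematicalPhysics.QuantumFieldTheory.Balaban1983to89.T4InputCauchyRateTermwise (TermHistExpLinear)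
open Summit.QuantumFields.BalabanUV.T4Continuum.B13HistMeasurable (MeasPotFrame B13HistM)
open Summit.QuantumFields.BalabanUV.T4Continuum.B13TermParamGaussianBi (BiCore)
open Summit.QuantumFields.BalabanUV.T4Continuum.NE1p.DressedSmallFieldAllowance (norm_sub_le_of_ball regen_le_of_slack)
open Summit.QuantumFields.BalabanUV.T4Continuum.NE1p.DressedSmallFieldOnCores (pencil_mem_ballClass norm_pencil_le)
open Summit.QuantumFields.BalabanUV.T4Continuum.NE1p.DressedSmallFieldOnCoresMass (norm_integral_coreDensity_le)
open Summit.QuantumFields.BalabanUV.T4Continuum.NE1p.DressedSmallFieldOnCoresSlot (termHistExpLinear_termAt)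
open Summit.QuantumFields.BalabanUV.T4Continuum.NE1p.DressedSourceAnalyticOnCores (analytic_and_bounded_locE_param_of_expLinear)

/-! ## §1 THE SCHWARZ LEMMA ITERATED ON THE (SOURCE, STRENGTH) BIDISC -/

section Bidisc
variable {F : Type*} [NormedAddCommGroup F] [NormedSpace ℂ F]

/-- **THE RE-BORN μ-PART IS BILINEAR IN (SOURCE, CONTENT)** [folklore — Schwarz iterated]: for `E : ℂ × ℂ → F` complex differentiable
on the bidisc `ball 0 μ₁ ×ˢ ball 0 (ε∕σ)` and bounded by `M` there, `0 < σ < ε` and `‖μ‖ < μ₁`, the mixed difference obeys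
`‖E(μ,1) − E(0,1) − (E(μ,0) − E(0,0))‖ ≤ 2·(2M∕μ₁·‖μ‖)∕ε·σ`: the owner's `norm_sub_le_of_ball` in the source at every strength bounds
`G(s) = E(μ,s) − E(0,s)` by `2M‖μ‖∕μ₁` on the strength disc, and `regen_le_of_slack` on `G` gives the claim. -/
theorem rebornMuPart_le_of_bidisc {E : ℂ × ℂ → F} {μ₁ σ ε M : ℝ} (hσ : 0 < σ) (hσε : σ < ε)
    (hd : DifferentiableOn ℂ E (ball (0 : ℂ) μ₁ ×ˢ ball (0 : ℂ) (ε / σ)))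
    (hM : ∀ z ∈ ball (0 : ℂ) μ₁ ×ˢ ball (0 : ℂ) (ε / σ), ‖E z‖ ≤ M) {μ : ℂ} (hμ : μ ∈ ball (0 : ℂ) μ₁) :
    ‖E (μ, 1) - E (0, 1) - (E (μ, 0) - E (0, 0))‖ ≤ 2 * (2 * M / μ₁ * ‖μ‖) / ε * σ := by
  have hμ₁ : 0 < μ₁ := lt_of_le_of_lt (norm_nonneg μ) (mem_ball_zero_iff.1 hμ)
  have h0 : (0 : ℂ) ∈ ball (0 : ℂ) μ₁ := mem_ball_self hμ₁
  -- the source sections at a fixed strength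
  have hsec : ∀ s ∈ ball (0 : ℂ) (ε / σ), DifferentiableOn ℂ (fun m : ℂ => E (m, s)) (ball (0 : ℂ) μ₁) := fun s hs =>
    hd.comp ((differentiableOn_id).prodMk (differentiableOn_const s)) fun m hm => ⟨hm, hs⟩
  have hGbound : ∀ s ∈ ball (0 : ℂ) (ε / σ), ‖E (μ, s) - E (0, s)‖ ≤ 2 * M / μ₁ * ‖μ‖ := by
    intro s hs
    have h := norm_sub_le_of_ball (f := fun m : ℂ => E (m, s)) (c := 0) (hsec s hs) (fun m hm => hM (m, s) ⟨hm, hs⟩) hμ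
    simpa only [sub_zero] using h
  -- the strength section of the μ-part
  have hG : DifferentiableOn ℂ (fun s : ℂ => E (μ, s) - E (0, s)) (ball (0 : ℂ) (ε / σ)) :=
    (hd.comp ((differentiableOn_const μ).prodMk differentiableOn_id) fun s hs => ⟨hμ, hs⟩).sub
      (hd.comp ((differentiableOn_const (0 : ℂ)).prodMk differentiableOn_id) fun s hs => ⟨h0, hs⟩)
  exact regen_le_of_slack (E := fun s : ℂ => E (μ, s) - E (0, s)) hσ hσε hG hGbound

/-- **… ON A SOURCE WINDOW: THE DRESSED REGENERATION CONSTANT `c̄_μ = 4Mμ₀∕(μ₁ε)`** [folklore]: for `‖μ‖ ≤ μ₀ < μ₁` (so `0 ≤ M` is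
forced nowhere — it is assumed) the mixed difference is `≤ (4·M·μ₀∕(μ₁·ε))·σ`, bilinear in (window, content) with a constant free of `μ`
and of the content. -/
theorem rebornMuPart_le_of_window {E : ℂ × ℂ → F} {μ₁ μ₀ σ ε M : ℝ} (hσ : 0 < σ) (hσε : σ < ε) (hM0 : 0 ≤ M)
    (hd : DifferentiableOn ℂ E (ball (0 : ℂ) μ₁ ×ˢ ball (0 : ℂ) (ε / σ)))
    (hM : ∀ z ∈ ball (0 : ℂ) μ₁ ×ˢ ball (0 : ℂ) (ε / σ), ‖E z‖ ≤ M) (h01 : μ₀ < μ₁) {μ : ℂ} (hμ : ‖μ‖ ≤ μ₀) :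
    ‖E (μ, 1) - E (0, 1) - (E (μ, 0) - E (0, 0))‖ ≤ 4 * M * μ₀ / (μ₁ * ε) * σ := by
  have hμ' : μ ∈ ball (0 : ℂ) μ₁ := mem_ball_zero_iff.2 (lt_of_le_of_lt hμ h01)
  have hμ₁ : 0 < μ₁ := lt_of_le_of_lt (norm_nonneg μ) (lt_of_le_of_lt hμ h01)
  have hε : 0 < ε := hσ.trans hσε
  refine (rebornMuPart_le_of_bidisc hσ hσε hd hM hμ').trans ?_
  have h1 : 2 * (2 * M / μ₁ * ‖μ‖) / ε * σ = 4 * M * ‖μ‖ / (μ₁ * ε) * σ := by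
    field_simp
    ring
  rw [h1]
  have h2 : 4 * M * ‖μ‖ / (μ₁ * ε) ≤ 4 * M * μ₀ / (μ₁ * ε) :=
    div_le_div_of_nonneg_right (mul_le_mul_of_nonneg_left hμ (by positivity)) (by positivity)
  exact mul_le_mul_of_nonneg_right h2 hσ.le

end Bidisc

/-! ## §2 EXP-LINEAR FAMILIES ALONG AN ABSTRACT TABLE MAP OF (SOURCE, STRENGTH), (B1a) DISCHARGED -/

section ExpLinear
variable {C : Carriers} {Op Hist : Type*} [NormedAddCommGroup Hist] [NormedSpace ℂ Hist] {ι : Type*}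
  {K : ℕ → (ℕ → ℝ) → C.BgB → Set (Op × Hist)} {T : ℕ → ι → Op → Hist → C.Dom → ℂ}
  {W : Set (ℕ → ℝ)} {α : ℕ → ι → Type*} [∀ k i, MeasurableSpace (α k i)] {μm : ∀ k i, Op → C.Dom → Measure (α k i)}
  {Φ : ∀ k i, Op → C.Dom → α k i → ℂ} {Λ : ∀ k i, Op → C.Dom → α k i → (Hist →L[ℂ] ℂ)}
variable (D : LocDomainSys) {Cube : Type} [DecidableEq Cube] (G : Geometry D Cube)

open Classical in
/-- **THE RE-BORN μ-PART OF THE DRESSED OUTPUT, (B1a) DISCHARGED** (kernel; S33 §2 `analytic_and_bounded_locE_param_of_expLinear` EXACTLY ONCE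
at `P := ℂ × ℂ`, `S := ball 0 μ₁ ×ˢ ball 0 (ε∕σ)` — JOINT holomorphy in (source, strength) + the (2.41) envelope — then §1 ONCE): along a
table map `hc : ℂ × ℂ → Hist` holomorphic on the bidisc keeping `(o, hc z)` in the class with table radius `R₀`, for `0 < σ < ε` and
`‖μ‖ < μ₁`, `‖E[act(μ,1)](X₀) − E[act(0,1)](X₀) − (E[act(μ,0)](X₀) − E[act(0,0)](X₀))‖ ≤ 2·(2M∕μ₁·‖μ‖)∕ε·σ` with
`M = e·ν·c₁·K₀²·A·e^{−r₁ d(X₀)}`. [folklore] -/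
theorem rebornMuPart_locE_le_of_expLinear (hexp : TermHistExpLinear K T W μm Φ Λ) {k : ℕ} {g : ℕ → ℝ} (hg : g ∈ W)
    {U : C.BgB} {o : Op} {hc : ℂ × ℂ → Hist} {μ₁ σ ε R₀ : ℝ} (hσ : 0 < σ) (hσε : σ < ε)
    (hcurve : DifferentiableOn ℂ hc (ball (0 : ℂ) μ₁ ×ˢ ball (0 : ℂ) (ε / σ)))
    (hK : ∀ z ∈ ball (0 : ℂ) μ₁ ×ˢ ball (0 : ℂ) (ε / σ), (o, hc z) ∈ K k g U)
    (hR : ∀ z ∈ ball (0 : ℂ) μ₁ ×ˢ ball (0 : ℂ) (ε / σ), ‖hc z‖ ≤ R₀)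
    {emb : D.Dom → C.Dom} (hscale : ∀ Z, C.scale (emb Z) = k) {terms : D.Dom → Finset ι} {act : ℂ × ℂ → D.Dom → ℂ}
    (hact : ∀ z ∈ ball (0 : ℂ) μ₁ ×ˢ ball (0 : ℂ) (ε / σ), ∀ Z, act z Z = ∑ i ∈ terms Z, T k i o (hc z) (emb Z))
    {N : D.Dom → ι → ℝ} (hN0 : ∀ Z i, 0 ≤ N Z i) (hN : ∀ Z, ∀ i ∈ terms Z, ∀ᵐ a ∂μm k i o (emb Z), ‖Λ k i o (emb Z) a‖ ≤ N Z i)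
    {A R r₁ b₅ : ℝ} {X₀ : D.Dom} (hA : 0 ≤ A) (hr₁ : 0 ≤ r₁) (hb : r₁ * 5 ≤ b₅)
    (hrate : r₁ + 2 * G.κ₀ + 2 ≤ R) (hsmall : A * Real.exp (b₅ + 1) * G.K₀ * G.ν * G.c₁ ≤ 1) (hL3 : ∀ Z, G.cubes Z ⊆ G.cubes X₀ →
      ∑ i ∈ terms Z, (∫ a, ‖Φ k i o (emb Z) a‖ ∂μm k i o (emb Z)) * Real.exp (N Z i * R₀) ≤ A * Real.exp (-(R * D.dj Z)))
    {μ : ℂ} (hμ : μ ∈ ball (0 : ℂ) μ₁) :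
    ‖locE G.ι G.cubes (act (μ, 1)) (G.cubes X₀) - locE G.ι G.cubes (act (0, 1)) (G.cubes X₀) -
        (locE G.ι G.cubes (act (μ, 0)) (G.cubes X₀) - locE G.ι G.cubes (act (0, 0)) (G.cubes X₀))‖ ≤
      2 * (2 * (Real.exp 1 * G.ν * G.c₁ * G.K₀ ^ 2 * A * Real.exp (-(r₁ * D.dj X₀))) / μ₁ * ‖μ‖) / ε * σ := by
  obtain ⟨hdE, hME⟩ := analytic_and_bounded_locE_param_of_expLinear D G hexp hg (isOpen_ball.prod isOpen_ball) hcurve hK hR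
    hscale hact hN0 hN hA hr₁ hb hrate hsmall hL3
  exact rebornMuPart_le_of_bidisc (E := fun z => locE G.ι G.cubes (act z) (G.cubes X₀)) hσ hσε hdE hME hμ

end ExpLinear

/-! ## §3 CORES WITH TERM-DEPENDENT POLYMER FAMILIES ALONG THE BI-PENCIL `h₀ + μ • u + s • v` -/

section Dep
variable {C : Carriers} {P : MeasPotFrame C} {Op : Type*} [NormedAddCommGroup Op] [NormedSpace ℂ Op] {ι : Type*}
  {𝒴 : ℕ → ι → Type*} {dom : ∀ k i, 𝒴 k i → C.Dom} {β : ℕ → ι → Type*} [∀ k i, MeasurableSpace (β k i)]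
  {α : ℕ → ι → Type*} [∀ k i, NormedAddCommGroup (α k i)] [∀ k i, InnerProductSpace ℝ (α k i)]
  [∀ k i, FiniteDimensional ℝ (α k i)] [∀ k i, MeasurableSpace (α k i)] [∀ k i, BorelSpace (α k i)]
variable (D : LocDomainSys) {Cube : Type} [DecidableEq Cube] (G : Geometry D Cube)

open Classical in
/-- **THE RE-BORN μ-PART FOR CORES WITH TERM-DEPENDENT POLYMER FAMILIES, (B1a) DISCHARGED, (B3) AS A LETTER BUDGET** (kernel; S33 §2's
parametric END EXACTLY ONCE at `P := ℂ × ℂ` with `hexp := termHistExpLinear_termAt` (N0r §1) along the BI-PENCIL `z ↦ h₀ + z.1 • u + z.2 • v`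
(source direction `u` on `‖z.1‖ < μ₁`, content `v` on `‖z.2‖ < ε∕‖v‖`), class membership and read-out growth by N0p's
`pencil_mem_ballClass` ∕ `norm_pencil_le` at the base point `h₀ + z.1 • u`, `hL3` from N0q's letter budget `hM3` via
`norm_integral_coreDensity_le` termwise; then §1 ONCE).  Binders = S33 §3's with the pencil doubled: `0 < ‖v‖ < ε`,
`hH : ‖h₀ − (ctr k g U).2‖ + μ₁‖u‖ + ε ≤ RHist k`, `hact` on the bidisc, `hM3` at the table radius `‖h₀‖ + μ₁‖u‖ + ε`.  Conclusion for
`‖μ‖ < μ₁`: the mixed difference of `E[act z](X₀)` over `{0, μ} × {0, 1}` is `≤ 2·(2M∕μ₁·‖μ‖)∕ε·‖v‖`. [folklore] -/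
theorem rebornMuPart_locE_le_of_coresAt_bipencil_mass {W : Set (ℕ → ℝ)}
    {ctr : ℕ → (ℕ → ℝ) → C.BgB → Op × B13HistM P} {ROp RHist R' : ℕ → ℝ}
    (𝔊 : ∀ k i, C.Dom → BiCore P (dom k i) Op (β k i) (α k i)) {mq bq N₀ : ℕ → ι → C.Dom → ℝ} (hroom : ∀ k, ROp k < R' k)
    (hm : ∀ k, ∀ g ∈ W, ∀ (U : C.BgB) (X : C.Dom), C.scale X = k → ∀ i, 0 < mq k i X)
    (hN : ∀ k, ∀ g ∈ W, ∀ (U : C.BgB) (X : C.Dom), C.scale X = k → ∀ i,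
      (∀ o ∈ ball (ctr k g U).1 (R' k), AEStronglyMeasurable ((𝔊 k i X).N o) (𝔊 k i X).lam) ∧
      (∀ p, DifferentiableOn ℂ (fun o => (𝔊 k i X).N o p) (ball (ctr k g U).1 (R' k))) ∧
      (∀ o ∈ ball (ctr k g U).1 (R' k), ∀ p, ‖(𝔊 k i X).N o p‖ ≤ N₀ k i X))
    (hq : ∀ k, ∀ g ∈ W, ∀ (U : C.BgB) (X : C.Dom), C.scale X = k → ∀ i,
      (∀ o ∈ ball (ctr k g U).1 (R' k),
        AEStronglyMeasurable (Function.uncurry ((𝔊 k i X).q o)) ((𝔊 k i X).lam.prod volume)) ∧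
      (∀ p v, DifferentiableOn ℂ (fun o => (𝔊 k i X).q o p v) (ball (ctr k g U).1 (R' k))) ∧
      (∀ o ∈ ball (ctr k g U).1 (R' k), ∀ p v, mq k i X * ‖v‖ ^ 2 - bq k i X ≤ ((𝔊 k i X).q o p v).re))
    {k : ℕ} {g : ℕ → ℝ} (hg : g ∈ W) {U : C.BgB} {o : Op} {h₀ u v : B13HistM P} {μ₁ ε : ℝ}
    (hv : 0 < ‖v‖) (hvε : ‖v‖ < ε)
    (hO : ‖o - (ctr k g U).1‖ ≤ ROp k) (hH : ‖h₀ - (ctr k g U).2‖ + μ₁ * ‖u‖ + ε ≤ RHist k)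
    {emb : D.Dom → C.Dom} (hscale : ∀ Z, C.scale (emb Z) = k) {terms : D.Dom → Finset ι} {act : ℂ × ℂ → D.Dom → ℂ}
    (hact : ∀ z ∈ ball (0 : ℂ) μ₁ ×ˢ ball (0 : ℂ) (ε / ‖v‖), ∀ Z,
      act z Z = ∑ i ∈ terms Z, (𝔊 k i (emb Z)).termAt o (h₀ + z.1 • u + z.2 • v))
    {A R r₁ b₅ : ℝ} {X₀ : D.Dom} (hA : 0 ≤ A) (hr₁ : 0 ≤ r₁) (hb : r₁ * 5 ≤ b₅)
    (hrate : r₁ + 2 * G.κ₀ + 2 ≤ R) (hsmall : A * Real.exp (b₅ + 1) * G.K₀ * G.ν * G.c₁ ≤ 1) (hM3 : ∀ Z, G.cubes Z ⊆ G.cubes X₀ →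
      ∑ i ∈ terms Z, (𝔊 k i (emb Z)).lam.real univ * ((𝔊 k i (emb Z)).wB * N₀ k i (emb Z) *
          Real.exp (bq k i (emb Z))) * (Real.pi / (mq k i (emb Z) / 2)) ^ (Module.finrank ℝ (α k i) / 2 : ℝ) *
        Real.exp ((𝔊 k i (emb Z)).N₁ * (‖h₀‖ + μ₁ * ‖u‖ + ε)) ≤ A * Real.exp (-(R * D.dj Z)))
    {μ : ℂ} (hμ : μ ∈ ball (0 : ℂ) μ₁) :
    ‖locE G.ι G.cubes (act (μ, 1)) (G.cubes X₀) - locE G.ι G.cubes (act (0, 1)) (G.cubes X₀) -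
        (locE G.ι G.cubes (act (μ, 0)) (G.cubes X₀) - locE G.ι G.cubes (act (0, 0)) (G.cubes X₀))‖ ≤
      2 * (2 * (Real.exp 1 * G.ν * G.c₁ * G.K₀ ^ 2 * A * Real.exp (-(r₁ * D.dj X₀))) / μ₁ * ‖μ‖) / ε * ‖v‖ := by
  have ho : o ∈ ball (ctr k g U).1 (R' k) := mem_ball.2 (by rw [dist_eq_norm]; exact lt_of_le_of_lt hO (hroom k))
  have hε : ε / ‖v‖ * ‖v‖ = ε := div_mul_cancel₀ ε hv.ne'
  -- the base point `h₀ + z.1 • u` of the strength pencil stays within `μ₁‖u‖` of `h₀`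
  have hbase : ∀ z ∈ ball (0 : ℂ) μ₁ ×ˢ ball (0 : ℂ) (ε / ‖v‖),
      ‖h₀ + z.1 • u - (ctr k g U).2‖ + ε / ‖v‖ * ‖v‖ ≤ RHist k := by
    intro z hz
    have h1 : ‖h₀ - (ctr k g U).2 + z.1 • u‖ ≤ ‖h₀ - (ctr k g U).2‖ + μ₁ * ‖u‖ := norm_pencil_le hz.1
    rw [hε, show h₀ + z.1 • u - (ctr k g U).2 = h₀ - (ctr k g U).2 + z.1 • u by abel]
    linarith
  have hK : ∀ z ∈ ball (0 : ℂ) μ₁ ×ˢ ball (0 : ℂ) (ε / ‖v‖), (o, h₀ + z.1 • u + z.2 • v) ∈ ballClass ctr ROp RHist k g U :=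
    fun z hz => pencil_mem_ballClass hO (hbase z hz) hz.2
  have hR : ∀ z ∈ ball (0 : ℂ) μ₁ ×ˢ ball (0 : ℂ) (ε / ‖v‖), ‖h₀ + z.1 • u + z.2 • v‖ ≤ ‖h₀‖ + μ₁ * ‖u‖ + ε := by
    intro z hz
    have h1 : ‖h₀ + z.1 • u‖ ≤ ‖h₀‖ + μ₁ * ‖u‖ := norm_pencil_le hz.1
    have h2 : ‖h₀ + z.1 • u + z.2 • v‖ ≤ ‖h₀ + z.1 • u‖ + ε / ‖v‖ * ‖v‖ := norm_pencil_le hz.2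
    rw [hε] at h2
    linarith
  have hcurve : DifferentiableOn ℂ (fun z : ℂ × ℂ => h₀ + z.1 • u + z.2 • v) (ball (0 : ℂ) μ₁ ×ˢ ball (0 : ℂ) (ε / ‖v‖)) :=
    (((differentiable_const h₀).add (differentiable_fst.smul_const u)).add (differentiable_snd.smul_const v)).differentiableOn
  have hjoint : DifferentiableOn ℂ (fun z => locE G.ι G.cubes (act z) (G.cubes X₀)) (ball (0 : ℂ) μ₁ ×ˢ ball (0 : ℂ) (ε / ‖v‖)) ∧
      ∀ z ∈ ball (0 : ℂ) μ₁ ×ˢ ball (0 : ℂ) (ε / ‖v‖), ‖locE G.ι G.cubes (act z) (G.cubes X₀)‖ ≤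
        Real.exp 1 * G.ν * G.c₁ * G.K₀ ^ 2 * A * Real.exp (-(r₁ * D.dj X₀)) := by
    refine analytic_and_bounded_locE_param_of_expLinear D G (termHistExpLinear_termAt 𝔊 hroom hm hN hq) hg
      (isOpen_ball.prod isOpen_ball) hcurve hK hR hscale hact (fun Z i => (𝔊 k i (emb Z)).N₁_nonneg)
      (fun Z i _ => Filter.Eventually.of_forall fun z => (𝔊 k i (emb Z)).norm_readOut_le z.1 z.2)
      hA hr₁ hb hrate hsmall (fun Z hZ => le_trans ?_ (hM3 Z hZ))
    refine Finset.sum_le_sum fun i _ => mul_le_mul_of_nonneg_right ?_ (Real.exp_pos _).le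
    simpa only [one_mul] using norm_integral_coreDensity_le (𝔊 k i (emb Z)) (hm k g hg U (emb Z) (hscale Z) i)
      (hN k g hg U (emb Z) (hscale Z) i).2.2 (hq k g hg U (emb Z) (hscale Z) i).2.2 ho
  exact rebornMuPart_le_of_bidisc (E := fun z => locE G.ι G.cubes (act z) (G.cubes X₀)) hv hvε hjoint.1 hjoint.2 hμ

open Classical in
/-- **… ON A SOURCE WINDOW — THE DRESSED REGENERATION CONSTANT AT THE CORES** (kernel; §3 + the window arithmetic of §1): for
`‖μ‖ ≤ μ₀ < μ₁` the mixed difference is `≤ (4·M·μ₀∕(μ₁·ε))·‖v‖`, `M = e·ν·c₁·K₀²·A·e^{−r₁ d(X₀)}` — what a family of content `v`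
regenerates INTO THE OBSERVABLE-ATTACHED PART is linear in `‖v‖` with the constant `c̄_μ = 4Mμ₀∕(μ₁ε)`, free of `μ` and of `v`.
[folklore] -/
theorem rebornMuPart_locE_le_of_coresAt_bipencil_mass_window {W : Set (ℕ → ℝ)}
    {ctr : ℕ → (ℕ → ℝ) → C.BgB → Op × B13HistM P} {ROp RHist R' : ℕ → ℝ}
    (𝔊 : ∀ k i, C.Dom → BiCore P (dom k i) Op (β k i) (α k i)) {mq bq N₀ : ℕ → ι → C.Dom → ℝ} (hroom : ∀ k, ROp k < R' k)
    (hm : ∀ k, ∀ g ∈ W, ∀ (U : C.BgB) (X : C.Dom), C.scale X = k → ∀ i, 0 < mq k i X)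
    (hN : ∀ k, ∀ g ∈ W, ∀ (U : C.BgB) (X : C.Dom), C.scale X = k → ∀ i,
      (∀ o ∈ ball (ctr k g U).1 (R' k), AEStronglyMeasurable ((𝔊 k i X).N o) (𝔊 k i X).lam) ∧
      (∀ p, DifferentiableOn ℂ (fun o => (𝔊 k i X).N o p) (ball (ctr k g U).1 (R' k))) ∧
      (∀ o ∈ ball (ctr k g U).1 (R' k), ∀ p, ‖(𝔊 k i X).N o p‖ ≤ N₀ k i X))
    (hq : ∀ k, ∀ g ∈ W, ∀ (U : C.BgB) (X : C.Dom), C.scale X = k → ∀ i,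
      (∀ o ∈ ball (ctr k g U).1 (R' k),
        AEStronglyMeasurable (Function.uncurry ((𝔊 k i X).q o)) ((𝔊 k i X).lam.prod volume)) ∧
      (∀ p v, DifferentiableOn ℂ (fun o => (𝔊 k i X).q o p v) (ball (ctr k g U).1 (R' k))) ∧
      (∀ o ∈ ball (ctr k g U).1 (R' k), ∀ p v, mq k i X * ‖v‖ ^ 2 - bq k i X ≤ ((𝔊 k i X).q o p v).re))
    {k : ℕ} {g : ℕ → ℝ} (hg : g ∈ W) {U : C.BgB} {o : Op} {h₀ u v : B13HistM P} {μ₁ μ₀ ε : ℝ} (h01 : μ₀ < μ₁)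
    (hv : 0 < ‖v‖) (hvε : ‖v‖ < ε)
    (hO : ‖o - (ctr k g U).1‖ ≤ ROp k) (hH : ‖h₀ - (ctr k g U).2‖ + μ₁ * ‖u‖ + ε ≤ RHist k)
    {emb : D.Dom → C.Dom} (hscale : ∀ Z, C.scale (emb Z) = k) {terms : D.Dom → Finset ι} {act : ℂ × ℂ → D.Dom → ℂ}
    (hact : ∀ z ∈ ball (0 : ℂ) μ₁ ×ˢ ball (0 : ℂ) (ε / ‖v‖), ∀ Z,
      act z Z = ∑ i ∈ terms Z, (𝔊 k i (emb Z)).termAt o (h₀ + z.1 • u + z.2 • v))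
    {A R r₁ b₅ : ℝ} {X₀ : D.Dom} (hA : 0 ≤ A) (hr₁ : 0 ≤ r₁) (hb : r₁ * 5 ≤ b₅)
    (hrate : r₁ + 2 * G.κ₀ + 2 ≤ R) (hsmall : A * Real.exp (b₅ + 1) * G.K₀ * G.ν * G.c₁ ≤ 1) (hM3 : ∀ Z, G.cubes Z ⊆ G.cubes X₀ →
      ∑ i ∈ terms Z, (𝔊 k i (emb Z)).lam.real univ * ((𝔊 k i (emb Z)).wB * N₀ k i (emb Z) *
          Real.exp (bq k i (emb Z))) * (Real.pi / (mq k i (emb Z) / 2)) ^ (Module.finrank ℝ (α k i) / 2 : ℝ) *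
        Real.exp ((𝔊 k i (emb Z)).N₁ * (‖h₀‖ + μ₁ * ‖u‖ + ε)) ≤ A * Real.exp (-(R * D.dj Z)))
    {μ : ℂ} (hμ : ‖μ‖ ≤ μ₀) :
    ‖locE G.ι G.cubes (act (μ, 1)) (G.cubes X₀) - locE G.ι G.cubes (act (0, 1)) (G.cubes X₀) -
        (locE G.ι G.cubes (act (μ, 0)) (G.cubes X₀) - locE G.ι G.cubes (act (0, 0)) (G.cubes X₀))‖ ≤
      4 * (Real.exp 1 * G.ν * G.c₁ * G.K₀ ^ 2 * A * Real.exp (-(r₁ * D.dj X₀))) * μ₀ / (μ₁ * ε) * ‖v‖ := by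
  have hμ' : μ ∈ ball (0 : ℂ) μ₁ := mem_ball_zero_iff.2 (lt_of_le_of_lt hμ h01)
  have hμ₁ : 0 < μ₁ := lt_of_le_of_lt (norm_nonneg μ) (lt_of_le_of_lt hμ h01)
  have hε : 0 < ε := hv.trans hvε
  have hM0 : 0 ≤ Real.exp 1 * G.ν * G.c₁ * G.K₀ ^ 2 * A * Real.exp (-(r₁ * D.dj X₀)) := by
    have := G.ν_nonneg; have := G.c₁_nonneg; positivity
  refine (rebornMuPart_locE_le_of_coresAt_bipencil_mass D G 𝔊 hroom hm hN hq hg hv hvε hO hH hscale hact hA hr₁ hb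
    hrate hsmall hM3 hμ').trans ?_
  set M := Real.exp 1 * G.ν * G.c₁ * G.K₀ ^ 2 * A * Real.exp (-(r₁ * D.dj X₀)) with hMdef
  have h1 : 2 * (2 * M / μ₁ * ‖μ‖) / ε * ‖v‖ = 4 * M * ‖μ‖ / (μ₁ * ε) * ‖v‖ := by
    field_simp
    ring
  rw [h1]
  have h2 : 4 * M * ‖μ‖ / (μ₁ * ε) ≤ 4 * M * μ₀ / (μ₁ * ε) :=
    div_le_div_of_nonneg_right (mul_le_mul_of_nonneg_left hμ (by positivity)) (by positivity)
  exact mul_le_mul_of_nonneg_right h2 hv.le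

end Dep

end Summit.QuantumFields.BalabanUV.T4Continuum.NE1p.DressedRebornMuPart

end
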